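import Summits.NavierStokesRegularity.NavierStokesRegularity.Theorems.EfficiencyFloorEnstrophyBudget
import Summits.NavierStokesRegularity.NavierStokesRegularity.Theorems.EfficiencyFloorBlowupEnstrophyUnbounded
import Summits.NavierStokesRegularity.NavierStokesRegularity.Theorems.EfficiencyFloorProductionEfficiencyDecayIntegrateEfficiency
import Summits.NavierStokesRegularity.NavierStokesRegularity.Theorems.EfficiencyFloorFloorOfEfficiencyDecay
import Summits.NavierStokesRegularity.NavierStokesRegularity.Theses.EfficiencyFloor
import HarnessLib

/-!
# Crux `EfficiencyFloor.ProductionEfficiencyDecay` (stmt-NavierStokesRegularity-22866): the LU–DOERING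
# THRESHOLD RUNG — the ε-law of the crux holds, verbatim, for every `ε ≥ C/ν³`

`--supports stmt-NavierStokesRegularity-22866` (line `efficiency_floor`, helper toward the crux-proper stub
`stub_depletionGivenBudget` = S2; seat ns-ef-p4).

WHAT IS PROVED (all unconditional, along every maximal smooth Leray–Hopf rapidly-decaying-datum solution
on `ℝ³ × [0,T)`):

* `young_envelope` / `deriv_le_cube`: the pointwise LU–DOERING CUBIC LAW from the landed budget
  (`EnstrophyBudget.main`, stmt-22995: `Ż = 2S − 2ν·Pal`, `|S| ≤ c Z^{3/4} Pal^{3/4}`): by the weighted AM–GM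
  inequality `2c Z^{3/4} Pal^{3/4} ≤ 2ν·Pal + (27c⁴/(128ν³)) Z³`, so `Ż ≤ A Z³` with `A = 27c⁴/(128ν³)`
  (Lu–Doering 2008: `dZ/dt ≤ (27c⁴/(128ν³)) Z³`; the polynomial identity
  `3X⁴ − 4X³Y + Y⁴ = (X − Y)²(2X² + (X+Y)²)` is the whole proof).
* `eventually_pos`: the crux's window-positivity clause is free — `Z > 0` on a late window (from the landed
  `BlowupEnstrophyUnbounded`, stmt-22867).
* `depletion_above_threshold`: the conclusion of the registered crux-proper stub S2
  (`∃ t₁ ∈ (0,T), ∀ t ∈ [t₁,T), 0 < Z ∧ 2S − 2ν·Pal ≤ ε Z³`) holds for every `ε ≥ 27c⁴/(128ν³)`.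
* `productionEfficiencyDecay_above_threshold`: the conclusion of the ROUTE DECL `ProductionEfficiencyDecay`
  (window positivity/finiteness and the every-subinterval law `Z(s)⁻² − Z(t)⁻² ≤ ε(t−s)`) holds verbatim for
  every `ε ≥ C/ν³`, with one universal `C` (`= 27c⁴/64`, `c` the budget constant).
* `leray_floor_eventually`: integrating the threshold law down from `Z(T⁻) = ∞` gives back exactly Leray's rate,
  `C' ν^{3/2}/√(T−t) ≤ Z(t)` eventually — the kernel check of the route rationale's sentence "the Lu–Doering law
  integrates EXACTLY to Leray's rate" (a re-derivation, in the route's vocabulary, of the tree's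
  `leray_blowup_rate_enstrophy`).

WHAT THIS SAYS ABOUT THE CRUX. `ProductionEfficiencyDecay` quantifies `∀ ε > 0`; this file proves it for
`ε ≥ C/ν³`. So the crux is EXACTLY the passage from the Lu–Doering threshold `C/ν³` down to `0⁺` (every
refutation must live strictly below the threshold; every window/positivity/finiteness clause is already true).
Nothing here makes progress on that passage: S2 below the threshold is open-problem grade (lead's census).

HONEST FRAMING: bookkeeping along a HYPOTHETICAL blow-up; the crux stmt-22866 is NOT proved; nothing about
NS regularity is asserted; no summit is proved.

References: L. Lu, C. R. Doering, Indiana Univ. Math. J. 57 (2008) 2693–2727, eq. (5)–(6);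
J. C. Robinson, J. L. Rodrigo, W. Sadowski, *The three-dimensional Navier–Stokes equations* (2016), (6.7) and
Lemma 6.13; J. Leray, Acta Math. 63 (1934) §19. [folklore]
-/

-- the problem directory repeats the summit name (`NavierStokesRegularity/NavierStokesRegularity`)
set_option linter.dupNamespace false

noncomputable section

open Set Filter MeasureTheory Topology
open scoped InnerProductSpace ENNReal NNReal
open Literature.Analysis.FluidPDE

namespace Summit.NavierStokesRegularity.NavierStokesRegularity.Theorems

namespace ProductionEfficiencyDecay

namespace LuDoeringRung

/-- **Weighted AM–GM in Lu–Doering form**: for `Z, P ≥ 0`, `ν > 0` and any real `c`,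
`2c Z^{3/4} P^{3/4} − 2ν P ≤ (27c⁴/(128ν³)) Z³`. With `X = 4ν P^{1/4}`, `Y = 3c Z^{3/4}` this is
`4X³Y ≤ 3X⁴ + Y⁴`, i.e. `0 ≤ (X−Y)²(2X² + (X+Y)²)`. [cite: LuDoering2008, eq. (6)] -/
theorem young_envelope {c ν Z P : ℝ} (hν : 0 < ν) (hZ : 0 ≤ Z) (hP : 0 ≤ P) :
    2 * (c * Z ^ (3 / 4 : ℝ) * P ^ (3 / 4 : ℝ)) - 2 * ν * P ≤ 27 * c ^ 4 / (128 * ν ^ 3) * Z ^ 3 := by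
  set a : ℝ := P ^ (1 / 4 : ℝ) with ha_def
  set b : ℝ := Z ^ (3 / 4 : ℝ) with hb_def
  have ha : 0 ≤ a := Real.rpow_nonneg hP _
  have hb : 0 ≤ b := Real.rpow_nonneg hZ _
  have hP1 : P = a ^ 4 := by
    rw [ha_def, ← Real.rpow_mul_natCast hP]
    norm_num
  have hP34 : P ^ (3 / 4 : ℝ) = a ^ 3 := by
    rw [ha_def, ← Real.rpow_mul_natCast hP]
    norm_num
  have hZ3 : Z ^ 3 = b ^ 4 := by
    rw [hb_def, ← Real.rpow_mul_natCast hZ]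
    norm_num
  rw [hP34, hZ3, hP1]
  have hν3 : 0 < 128 * ν ^ 3 := by positivity
  rw [div_mul_eq_mul_div, le_div_iff₀ hν3]
  -- `X = 4 ν a`, `Y = 3 c b`
  have key : 0 ≤ (4 * ν * a - 3 * c * b) ^ 2 * (2 * (4 * ν * a) ^ 2 + (4 * ν * a + 3 * c * b) ^ 2) := by
    positivity
  nlinarith [key, ha, hb, hν]

/-- **The pointwise Lu–Doering cubic law** from the budget envelope: if `|S| ≤ c Z^{3/4} Pal^{3/4}` with
`Z, Pal ≥ 0`, then `2S − 2ν·Pal ≤ (27c⁴/(128ν³)) Z³`. [cite: LuDoering2008, eq. (6)] -/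
theorem deriv_le_cube {c ν Z P S : ℝ} (hν : 0 < ν) (hZ : 0 ≤ Z) (hP : 0 ≤ P)
    (hS : |S| ≤ c * Z ^ (3 / 4 : ℝ) * P ^ (3 / 4 : ℝ)) :
    2 * S - 2 * ν * P ≤ 27 * c ^ 4 / (128 * ν ^ 3) * Z ^ 3 := by
  have h1 : S ≤ c * Z ^ (3 / 4 : ℝ) * P ^ (3 / 4 : ℝ) := (le_abs_self S).trans hS
  have h2 := young_envelope (c := c) hν hZ hP
  linarith

/-- **Window positivity is free**: along a maximal smooth Leray–Hopf rapidly-decaying-datum solution, any real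
enstrophy function `Zr` with `∫⁻‖curl u(t)‖ₑ² = ofReal (Zr t)` on `(0,T)` is `≥ 1` (hence positive) on a late
window `[t₁,T)`, `0 < t₁ < T` (from the landed `BlowupEnstrophyUnbounded`, stmt-22867). [folklore] -/
theorem eventually_one_le {ν T : ℝ} (hν : 0 < ν) (hT : 0 < T)
    {u : ℝ → EuclideanSpace ℝ (Fin 3) → EuclideanSpace ℝ (Fin 3)} {p : ℝ → EuclideanSpace ℝ (Fin 3) → ℝ}
    (hmax : IsMaximalSmoothSolution ν 0 u p T) (hLH : IsLerayHopfOn T ν 0 (u 0) u)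
    (hdec : HasRapidSpatialDecay (u 0)) {Zr : ℝ → ℝ}
    (hZ : ∀ t ∈ Ioo 0 T, ∫⁻ x, ‖curl (u t) x‖ₑ ^ 2 = ENNReal.ofReal (Zr t)) :
    ∃ t₁ ∈ Ioo 0 T, ∀ t ∈ Ico t₁ T, 1 ≤ Zr t := by
  have h1 := BlowupEnstrophyUnbounded.main hν hT hmax hLH hdec 1
  obtain ⟨t₀, ht₀T, hsub⟩ := mem_nhdsLT_iff_exists_Ioo_subset.1 h1
  set t₁ : ℝ := (max t₀ 0 + T) / 2 with ht₁
  have hm : max t₀ 0 < T := max_lt ht₀T hT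
  have ht₁I : t₁ ∈ Ioo 0 T := ⟨by rw [ht₁]; linarith [le_max_right t₀ 0], by rw [ht₁]; linarith⟩
  refine ⟨t₁, ht₁I, fun t ht => ?_⟩
  have ht₀t : t₀ < t := by
    have : max t₀ 0 < t₁ := by rw [ht₁]; linarith
    exact (le_max_left t₀ 0).trans_lt (this.trans_le ht.1)
  have htI : t ∈ Ioo 0 T := ⟨ht₁I.1.trans_le ht.1, ht.2⟩
  have h2 : ENNReal.ofReal 1 ≤ ∫⁻ x, ‖curl (u t) x‖ₑ ^ 2 := hsub ⟨ht₀t, ht.2⟩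
  rw [hZ t htI, ENNReal.ofReal_le_ofReal_iff'] at h2
  rcases h2 with h2 | h2
  · exact h2
  · exact absurd h2 (by norm_num)

/-- **S2 ABOVE THE LU–DOERING THRESHOLD.** With the hypotheses of the registered crux-proper stub
`stub_depletionGivenBudget` (the budget triple `Zr, Pr, Sr` of a maximal smooth Leray–Hopf rapidly-decaying-datum
solution, verbatim), its conclusion `∃ t₁ ∈ (0,T), ∀ t ∈ [t₁,T), 0 < Zr t ∧ 2 Sr t − 2ν Pr t ≤ ε (Zr t)³` holds for
every `ε ≥ 27c⁴/(128ν³)`. The crux proper is the same conclusion for every `ε > 0`; that is NOT proved here.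
[cite: LuDoering2008, eq. (6)] -/
theorem depletion_above_threshold :
    ∀ (c ν T : ℝ), 0 < c → 0 < ν → 0 < T →
      ∀ (u : ℝ → EuclideanSpace ℝ (Fin 3) → EuclideanSpace ℝ (Fin 3)) (p : ℝ → EuclideanSpace ℝ (Fin 3) → ℝ),
        Literature.Analysis.FluidPDE.IsMaximalSmoothSolution ν 0 u p T →
        Literature.Analysis.FluidPDE.IsLerayHopfOn T ν 0 (u 0) u →
        Literature.Analysis.FluidPDE.HasRapidSpatialDecay (u 0) →
        ∀ (Zr Pr Sr : ℝ → ℝ), (∀ t ∈ Set.Ioo 0 T,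
          ∫⁻ x, ‖Literature.Analysis.FluidPDE.curl (u t) x‖ₑ ^ 2 = ENNReal.ofReal (Zr t) ∧ 0 ≤ Zr t ∧
          0 ≤ Pr t ∧
          Pr t = ∫ x, Literature.Analysis.FluidPDE.frobeniusNormSq
            (fderiv ℝ (Literature.Analysis.FluidPDE.curl (u t)) x) ∧
          Sr t = ∫ x, ⟪Literature.Analysis.FluidPDE.curl (u t) x,
            fderiv ℝ (u t) x (Literature.Analysis.FluidPDE.curl (u t) x)⟫_ℝ ∧
          HasDerivAt Zr (2 * Sr t - 2 * ν * Pr t) t ∧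
          |Sr t| ≤ c * Zr t ^ (3 / 4 : ℝ) * Pr t ^ (3 / 4 : ℝ)) →
        ∀ ε : ℝ, 27 * c ^ 4 / (128 * ν ^ 3) ≤ ε →
          ∃ t₁ ∈ Set.Ioo 0 T, ∀ t ∈ Set.Ico t₁ T, 0 < Zr t ∧ 2 * Sr t - 2 * ν * Pr t ≤ ε * Zr t ^ 3 := by
  intro c ν T _ hν hT u p hmax hLH hdec Zr Pr Sr hB ε hε
  obtain ⟨t₁, ht₁, hone⟩ := eventually_one_le hν hT hmax hLH hdec (fun t ht => (hB t ht).1)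
  refine ⟨t₁, ht₁, fun t ht => ?_⟩
  have htI : t ∈ Ioo 0 T := ⟨ht₁.1.trans_le ht.1, ht.2⟩
  obtain ⟨-, hZ0, hP0, -, -, -, hS⟩ := hB t htI
  have hZpos : 0 < Zr t := one_pos.trans_le (hone t ht)
  refine ⟨hZpos, (deriv_le_cube hν hZ0 hP0 hS).trans ?_⟩
  exact mul_le_mul_of_nonneg_right hε (pow_nonneg hZ0 3)

/-- **THE ROUTE DECL'S ε-LAW ABOVE THE THRESHOLD.** There is a universal `C > 0` such that along every maximal
smooth Leray–Hopf rapidly-decaying-datum solution on `[0,T)` and for every `ε ≥ C/ν³` the conclusion of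
`EfficiencyFloor.ProductionEfficiencyDecay` holds verbatim: a late window `[t₁,T)` on which the enstrophy is
positive and finite and `Z(s)⁻² − Z(t)⁻² ≤ ε (t − s)` for all `t₁ ≤ s ≤ t < T`. (`C = 27c⁴/64`, `c` the constant
of the landed budget stmt-22995.) The crux asks this for every `ε > 0`; NOT proved here.
[cite: LuDoering2008, eq. (6)] -/
theorem productionEfficiencyDecay_above_threshold :
    ∃ C : ℝ, 0 < C ∧ ∀ (ν T : ℝ), 0 < ν → 0 < T →
      ∀ (u : ℝ → EuclideanSpace ℝ (Fin 3) → EuclideanSpace ℝ (Fin 3)) (p : ℝ → EuclideanSpace ℝ (Fin 3) → ℝ),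
        Literature.Analysis.FluidPDE.IsMaximalSmoothSolution ν 0 u p T →
        Literature.Analysis.FluidPDE.IsLerayHopfOn T ν 0 (u 0) u →
        Literature.Analysis.FluidPDE.HasRapidSpatialDecay (u 0) →
        ∀ ε : ℝ, C / ν ^ 3 ≤ ε → ∃ t₁ ∈ Set.Ico 0 T,
          (∀ t ∈ Set.Ico t₁ T, 0 < ∫⁻ x, ‖Literature.Analysis.FluidPDE.curl (u t) x‖ₑ ^ 2 ∧
            ∫⁻ x, ‖Literature.Analysis.FluidPDE.curl (u t) x‖ₑ ^ 2 < ⊤) ∧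
          ∀ s t : ℝ, t₁ ≤ s → s ≤ t → t < T →
            ((∫⁻ x, ‖Literature.Analysis.FluidPDE.curl (u s) x‖ₑ ^ 2).toReal)⁻¹ ^ 2 -
              ((∫⁻ x, ‖Literature.Analysis.FluidPDE.curl (u t) x‖ₑ ^ 2).toReal)⁻¹ ^ 2 ≤ ε * (t - s) := by
  obtain ⟨c, hc, hB⟩ := EnstrophyBudget.main
  refine ⟨27 * c ^ 4 / 64, by positivity, ?_⟩
  intro ν T hν hT u p hmax hLH hdec ε hε
  obtain ⟨Zr, Pr, Sr, hZ⟩ := hB ν T hν hT u p hmax hLH hdec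
  have hthr : 27 * c ^ 4 / (128 * ν ^ 3) ≤ ε / 2 := by
    have h1 : 27 * c ^ 4 / (128 * ν ^ 3) = 27 * c ^ 4 / 64 / ν ^ 3 / 2 := by
      field_simp
      ring
    rw [h1]
    linarith
  obtain ⟨t₁, ht₁, hdep⟩ :=
    depletion_above_threshold c ν T hc hν hT u p hmax hLH hdec Zr Pr Sr hZ (ε / 2) hthr
  have hIoo : ∀ t ∈ Ico t₁ T, t ∈ Ioo 0 T := fun t ht => ⟨ht₁.1.trans_le ht.1, ht.2⟩
  have hpos : ∀ t ∈ Ico t₁ T, 0 < Zr t := fun t ht => (hdep t ht).1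
  have hder : ∀ t ∈ Ico t₁ T, ∃ D : ℝ, HasDerivAt Zr D t ∧ D ≤ ε / 2 * Zr t ^ 3 := fun t ht =>
    ⟨2 * Sr t - 2 * ν * Pr t, (hZ t (hIoo t ht)).2.2.2.2.2.1, (hdep t ht).2⟩
  refine ⟨t₁, ⟨ht₁.1.le, ht₁.2⟩, fun t ht => ?_, fun s t hs hst htT => ?_⟩
  · rw [(hZ t (hIoo t ht)).1]
    exact ⟨ENNReal.ofReal_pos.2 (hpos t ht), ENNReal.ofReal_lt_top⟩
  · have hsI : s ∈ Ico t₁ T := ⟨hs, hst.trans_lt htT⟩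
    have htI : t ∈ Ico t₁ T := ⟨hs.trans hst, htT⟩
    rw [(hZ s (hIoo s hsI)).1, (hZ t (hIoo t htI)).1, ENNReal.toReal_ofReal (hpos s hsI).le,
      ENNReal.toReal_ofReal (hpos t htI).le]
    have h := stub_integrateEfficiency Zr t₁ T (ε / 2) hpos hder s t hs hst htT
    linarith

/-- **The threshold law integrates back to Leray's rate** (route vocabulary): there is a universal `C' > 0` with
`C' ν^{3/2}/√(T−t) ≤ ∫|curl u(t)|²` eventually as `t ↑ T`, along every maximal smooth Leray–Hopf
rapidly-decaying-datum solution — from `Z(s)⁻² ≤ (C/ν³)(T−s)` (the threshold law integrated down from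
`Z(T⁻) = ∞`, real-analysis core `FloorOfEfficiencyDecay.inv_sq_le` of the landed stmt-22868). A re-derivation of
the tree's `leray_blowup_rate_enstrophy` in this line's vocabulary; recorded to certify the rationale's "the
Lu–Doering law integrates exactly to Leray's rate". [cite: RobinsonRodrigoSadowski2016, Lemma 6.13] -/
theorem leray_floor_eventually :
    ∃ C' : ℝ, 0 < C' ∧ ∀ (ν T : ℝ), 0 < ν → 0 < T →
      ∀ (u : ℝ → EuclideanSpace ℝ (Fin 3) → EuclideanSpace ℝ (Fin 3)) (p : ℝ → EuclideanSpace ℝ (Fin 3) → ℝ),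
        Literature.Analysis.FluidPDE.IsMaximalSmoothSolution ν 0 u p T →
        Literature.Analysis.FluidPDE.IsLerayHopfOn T ν 0 (u 0) u →
        Literature.Analysis.FluidPDE.HasRapidSpatialDecay (u 0) →
        ∀ᶠ t in 𝓝[<] T, ENNReal.ofReal (C' * ν ^ (3 / 2 : ℝ) / Real.sqrt (T - t)) ≤
          ∫⁻ x, ‖Literature.Analysis.FluidPDE.curl (u t) x‖ₑ ^ 2 := by
  obtain ⟨C, hC, hlaw⟩ := productionEfficiencyDecay_above_threshold
  refine ⟨1 / Real.sqrt C, by positivity, ?_⟩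
  intro ν T hν hT u p hmax hLH hdec
  set ε : ℝ := C / ν ^ 3 with hεdef
  have hε : 0 < ε := by positivity
  obtain ⟨t₁, ht₁, hwin, hdecay⟩ := hlaw ν T hν hT u p hmax hLH hdec ε le_rfl
  set Z : ℝ → ℝ := fun t => (∫⁻ x, ‖curl (u t) x‖ₑ ^ 2).toReal with hZ
  have hU := BlowupEnstrophyUnbounded.main hν hT hmax hLH hdec
  -- every level is reached after every `s < T`
  have hunb : ∀ s < T, ∀ N : ℝ, ∃ t ∈ Ioo s T, N ≤ Z t := by
    intro s hs N
    have h1 := hU (max N 0)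
    have h2 : ∀ᶠ t in 𝓝[<] T, t ∈ Ioo (max s t₁) T := Ioo_mem_nhdsLT (max_lt hs ht₁.2)
    obtain ⟨t, hNt, ht⟩ := (h1.and h2).exists
    have htI : t ∈ Ico t₁ T := ⟨(le_max_right _ _).trans ht.1.le, ht.2⟩
    have htop : ∫⁻ x, ‖curl (u t) x‖ₑ ^ 2 ≠ ⊤ := (hwin t htI).2.ne
    refine ⟨t, ⟨(le_max_left _ _).trans_lt ht.1, ht.2⟩, ?_⟩
    have h3 : max N 0 ≤ Z t := (ENNReal.ofReal_le_iff_le_toReal htop).1 hNt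
    exact (le_max_left _ _).trans h3
  have hdec' : ∀ s t : ℝ, t₁ ≤ s → s ≤ t → t < T → (Z s)⁻¹ ^ 2 - (Z t)⁻¹ ^ 2 ≤ ε * (t - s) :=
    fun s t h1 h2 h3 => hdecay s t h1 h2 h3
  have hIco : ∀ᶠ t in 𝓝[<] T, t ∈ Ico t₁ T := Ico_mem_nhdsLT ht₁.2
  filter_upwards [hIco] with s hs
  have hpos := (hwin s hs).1
  have htop := (hwin s hs).2
  have hZs : 0 < Z s := ENNReal.toReal_pos hpos.ne' htop.ne
  have hinv : (Z s)⁻¹ ^ 2 ≤ ε * (T - s) := FloorOfEfficiencyDecay.inv_sq_le hε.le hdec' hunb hs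
  have hTs : 0 < T - s := sub_pos.2 hs.2
  -- `Z(s) ≥ (ε (T−s))^{-1/2} = ν^{3/2} / (√C √(T−s))`
  have hfloor : 1 / Real.sqrt C * ν ^ (3 / 2 : ℝ) / Real.sqrt (T - s) ≤ Z s := by
    -- `1 ≤ ε (T-s) Z(s)²`
    have h1 : 1 ≤ ε * (T - s) * Z s ^ 2 := by
      have h2 : (Z s ^ 2)⁻¹ ≤ ε * (T - s) := by rwa [inv_pow] at hinv
      rw [inv_le_iff_one_le_mul₀ (pow_pos hZs 2)] at h2
      linarith
    have hν32 : ν ^ (3 / 2 : ℝ) = Real.sqrt (ν ^ 3) := by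
      rw [show (3 / 2 : ℝ) = ((3 : ℕ) : ℝ) * (1 / 2 : ℝ) by norm_num, Real.rpow_natCast_mul hν.le,
        Real.sqrt_eq_rpow]
    have hL : 1 / Real.sqrt C * ν ^ (3 / 2 : ℝ) / Real.sqrt (T - s) =
        Real.sqrt (ν ^ 3 / (C * (T - s))) := by
      rw [hν32, Real.sqrt_div (pow_nonneg hν.le 3), Real.sqrt_mul hC.le, one_div, inv_mul_eq_div,
        div_div]
    rw [hL, ← Real.sqrt_sq hZs.le]
    apply Real.sqrt_le_sqrt
    rw [div_le_iff₀ (by positivity)]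
    have h5 : ε * ν ^ 3 = C := by rw [hεdef]; field_simp
    have h6 : ν ^ 3 * 1 ≤ ν ^ 3 * (ε * (T - s) * Z s ^ 2) :=
      mul_le_mul_of_nonneg_left h1 (pow_pos hν 3).le
    have h7 : ν ^ 3 * (ε * (T - s) * Z s ^ 2) = Z s ^ 2 * (C * (T - s)) := by rw [← h5]; ring
    linarith [h6, h7]
  calc ENNReal.ofReal (1 / Real.sqrt C * ν ^ (3 / 2 : ℝ) / Real.sqrt (T - s))
      ≤ ENNReal.ofReal (Z s) := ENNReal.ofReal_le_ofReal hfloor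
    _ = ∫⁻ x, ‖curl (u s) x‖ₑ ^ 2 := ENNReal.ofReal_toReal htop.ne

end LuDoeringRung

end ProductionEfficiencyDecay

end Summit.NavierStokesRegularity.NavierStokesRegularity.Theorems

end
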